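import Summits.KontsevichZagierPeriods.KontsevichZagierPeriods.Theorems.SoloInformedSegMult
import Literature.NumberTheory.Transcendental.BakerRelationDecomposition
import HarnessLib
import HarnessLib.Audit

/-!
# SoloInformed — the null theorem for points and segments (Baker)

Solo programme `solo-KontsevichZagierPeriods-informed`, session s112 (kernel project
«`SoloInformedKZPUpTo 1` unconditionally from the tree's kernel Baker theorem»), file 6.

**Null theorem** (`soloInformed_ptRep_add_segRep_sum_mem_relations`): if `a ∈ ℚ̄ ∩ ℝ`,
`(g_k, c_k)` are admissible and `a + Σ_k Re(g_k Log c_k) = 0`, then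
`[pt, a] + Σ_k Seg(g_k, c_k)` is a relation of the Kontsevich–Zagier calculus.

Proof.  Halve every `c_k` (`Seg(g,c) ≡ Seg(2g,√c) ≡ Seg(g,√c) + Seg(ḡ, conj √c)`, conjugation
symmetry), so that the value becomes the GENUINE `ℚ̄`-linear form
`a + Σ_i γ_i Log e_i` (`i ∈ κ ⊕ κ`, `e = (√c, conj √c)`, `γ = (g, ḡ)`) in logarithms of algebraic
numbers.  The tree's kernel form of Baker's theorem (`baker_decomposition_complex`) gives `a = 0`
and `γ = Σ_j γ_j N_j` with RATIONAL relations `N_j` of the `Log e_i`; clearing a common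
denominator `D`, `γ_i = Σ_j β_j M_{ji}` with `β_j = γ_j / D ∈ ℚ̄` and INTEGER relations `M_j`.
Linearity of `Seg` in the coefficient and the integer null relations
(`soloInformed_zsmul_segRep_sum_mem_relations`) finish the proof.  No torsion argument in
`FormalRep / relations` is needed: the factor `2` of `z + z̄ = 2 Re z` is absorbed by halving.

References: A. Baker, *Transcendental Number Theory* (1975), Thm. 2.1 (via the tree's
`baker_decomposition_complex`); M. Kontsevich, D. Zagier, *Periods* (2001), §1.2; this work.
-/

noncomputable section

open scoped BigOperators ComplexConjugate
open MeasureTheory Set Filter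
open Literature.ModelTheory.ExponentialFields
open Literature.NumberTheory.Transcendental Literature.NumberTheory.Transcendental.KZ

namespace Summit.KontsevichZagierPeriods.KontsevichZagierPeriods.Theorems

/-! ### Finite sums of coefficients -/

/-- A finite sum of algebraic numbers is algebraic. -/
theorem soloInformed_isAlgebraic_finset_sum {ι : Type*} {x : ι → ℂ} (s : Finset ι)
    (hx : ∀ j ∈ s, IsAlgebraic ℚ (x j)) : IsAlgebraic ℚ (∑ j ∈ s, x j) :=
  Finset.sum_induction _ (fun z => IsAlgebraic ℚ z) (fun _ _ ha hb => ha.add hb)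
    isAlgebraic_zero hx

/-- Additivity of `Seg` in the coefficient, finite-sum form. -/
theorem soloInformed_segRep_finset_sum_sub_mem_relations {ι : Type*} {x : ι → ℂ} (c : ℂ)
    (s : Finset ι) (hx : ∀ j ∈ s, IsAlgebraic ℚ (x j)) :
    of (soloInformedSegRep (∑ j ∈ s, x j) c) - ∑ j ∈ s, of (soloInformedSegRep (x j) c) ∈
      relations := by
  classical
  induction s using Finset.induction_on with
  | empty => simpa using soloInformed_segRep_zero_mem_relations c
  | insert a s ha ih =>
    rw [Finset.sum_insert ha, Finset.sum_insert ha]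
    have hxa := hx a (Finset.mem_insert_self a s)
    have hxs : ∀ j ∈ s, IsAlgebraic ℚ (x j) := fun j hj => hx j (Finset.mem_insert_of_mem hj)
    have h1 := soloInformed_segRep_add_sub_mem_relations hxa
      (soloInformed_isAlgebraic_finset_sum s hxs) c
    have := relations.add_mem h1 (ih hxs)
    convert this using 1
    abel

/-! ### The null theorem -/

/-- **Null theorem for points and segments.** If `a` is real algebraic, every `(g_k, c_k)` is
admissible and `a + Σ_k Re(g_k Log c_k) = 0`, then `[pt, a] + Σ_k Seg(g_k, c_k)` is a
relation.  [Baker 1975, Thm. 2.1 via `baker_decomposition_complex`; this work] -/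
theorem soloInformed_ptRep_add_segRep_sum_mem_relations {κ : Type} [Fintype κ] [DecidableEq κ]
    {a : ℝ} (ha : IsAlgebraic ℚ a) {g c : κ → ℂ} (hadm : ∀ k, SoloInformedSegAdm (g k) (c k))
    (h0 : a + ∑ k, (g k * Complex.log (c k)).re = 0) :
    of (soloInformedPtRep a ha) + ∑ k, of (soloInformedSegRep (g k) (c k)) ∈ relations := by
  classical
  -- square roots
  set d : κ → ℂ := fun k => soloInformedSqrt (c k) with hd_def
  have hc0 : ∀ k, c k ≠ 0 := fun k => Complex.slitPlane_ne_zero (hadm k).2.2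
  have hdalg : ∀ k, IsAlgebraic ℚ (d k) := fun k =>
    soloInformed_sqrt_isAlgebraic (hadm k).2.1 (hc0 k)
  have hdre : ∀ k, 0 < (d k).re := fun k => soloInformed_sqrt_re_pos (hadm k).2.2
  have hdlog : ∀ k, Complex.log (d k) = Complex.log (c k) / 2 := fun k =>
    soloInformed_log_sqrt (c k)
  have hgalg : ∀ k, IsAlgebraic ℚ (g k) := fun k => (hadm k).1
  -- the doubled family on `κ ⊕ κ`
  set e : κ ⊕ κ → ℂ := Sum.elim d (fun k => conj (d k)) with he_def
  set γ : κ ⊕ κ → ℂ := Sum.elim g (fun k => conj (g k)) with hγ_def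
  have healg : ∀ i, IsAlgebraic ℚ (e i) := by
    rintro (k | k)
    · exact hdalg k
    · exact soloInformed_isAlgebraic_conj_iff.2 (hdalg k)
  have here : ∀ i, 0 < (e i).re := by
    rintro (k | k)
    · exact hdre k
    · show 0 < (conj (d k)).re
      rw [Complex.conj_re]
      exact hdre k
  have hesp : ∀ i, e i ∈ Complex.slitPlane := fun i =>
    Complex.mem_slitPlane_iff.2 (Or.inl (here i))
  have he0 : ∀ i, e i ≠ 0 := fun i => Complex.slitPlane_ne_zero (hesp i)
  have hγalg : ∀ i, IsAlgebraic ℚ (γ i) := by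
    rintro (k | k)
    · exact hgalg k
    · exact soloInformed_isAlgebraic_conj_iff.2 (hgalg k)
  -- the `ℚ̄`-linear relation `a + Σ γ_i Log e_i = 0`
  have hlogconj : ∀ k, Complex.log (conj (d k)) = conj (Complex.log (d k)) := fun k => by
    rw [Complex.log_conj_eq_ite, if_neg (soloInformed_arg_ne_pi_of_re_pos (hdre k))]
  have hk : ∀ k, g k * Complex.log (d k) + conj (g k) * Complex.log (conj (d k)) =
      (((g k * Complex.log (c k)).re : ℝ) : ℂ) := by
    intro k
    rw [hlogconj, ← map_mul, Complex.add_conj, hdlog, ← mul_div_assoc, Complex.div_ofNat_re]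
    push_cast
    ring
  have hrel : ((a : ℝ) : ℂ) + ∑ i, γ i * Complex.log (e i) = 0 := by
    rw [Fintype.sum_sum_type]
    simp only [he_def, hγ_def, Sum.elim_inl, Sum.elim_inr]
    rw [← Finset.sum_add_distrib]
    simp_rw [hk]
    rw [← Complex.ofReal_sum, ← Complex.ofReal_add, h0, Complex.ofReal_zero]
  -- Baker
  have haC : IsAlgebraic ℚ ((a : ℝ) : ℂ) := by simpa using ha.algebraMap (A := ℂ)
  obtain ⟨ha0, N, hN, hγN⟩ := baker_decomposition_complex (fun i => Complex.log (e i))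
    (fun i => by rw [Complex.exp_log (he0 i)]; exact healg i) haC hγalg hrel
  have ha0' : a = 0 := by exact_mod_cast ha0
  -- a common denominator `D` of the rational relation matrix `N`
  set D : ℕ := ∏ p : (κ ⊕ κ) × (κ ⊕ κ), (N p.1 p.2).den with hD
  have hDpos : 0 < D := Finset.prod_pos fun p _ => (N p.1 p.2).den_pos
  have hD0 : (D : ℂ) ≠ 0 := by exact_mod_cast hDpos.ne'
  have hM : ∀ j i, ∃ m : ℤ, (m : ℚ) = N j i * D := by
    intro j i
    refine ⟨(N j i).num * ∏ p ∈ Finset.univ.erase (j, i), ((N p.1 p.2).den : ℤ), ?_⟩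
    rw [hD, ← Finset.prod_erase_mul _ _ (Finset.mem_univ (j, i))]
    push_cast
    rw [show N j i * ((∏ p ∈ Finset.univ.erase (j, i), ((N p.1 p.2).den : ℚ)) * ((N j i).den : ℚ))
        = (N j i * (N j i).den) * ∏ p ∈ Finset.univ.erase (j, i), ((N p.1 p.2).den : ℚ) by ring,
      Rat.mul_den_eq_num]
  choose M hM using hM
  have hcast : ∀ j i, (M j i : ℂ) = ((N j i : ℚ) : ℂ) * (D : ℂ) := fun j i => by
    have := congrArg (fun q : ℚ => (q : ℂ)) (hM j i)
    push_cast at this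
    exact this
  set β : κ ⊕ κ → ℂ := fun j => γ j / D with hβ
  have hDalg : IsAlgebraic ℚ (D : ℂ) := by simpa using isAlgebraic_nat (R := ℚ) (A := ℂ) D
  have hβalg : ∀ j, IsAlgebraic ℚ (β j) := fun j => by
    show IsAlgebraic ℚ (γ j / D)
    rw [div_eq_mul_inv]
    exact (hγalg j).mul hDalg.inv
  -- integer relations among the `Log e_i`
  have hMrel : ∀ j, ∑ i, (M j i : ℂ) * Complex.log (e i) = 0 := by
    intro j
    simp_rw [hcast]
    rw [show ∑ i, ((N j i : ℚ) : ℂ) * (D : ℂ) * Complex.log (e i) =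
        (D : ℂ) * ∑ i, ((N j i : ℚ) : ℂ) * Complex.log (e i) by
      rw [Finset.mul_sum]; exact Finset.sum_congr rfl fun _ _ => by ring, hN j, mul_zero]
  -- `γ_i = Σ_j M_{ji} β_j`
  have hγM : ∀ i, γ i = ∑ j, (M j i : ℂ) * β j := by
    intro i
    rw [hγN i]
    refine Finset.sum_congr rfl fun j _ => ?_
    show γ j * ((N j i : ℚ) : ℂ) = (M j i : ℂ) * (γ j / D)
    rw [hcast]
    field_simp
  -- Step 1–2: halving and conjugate doubling
  have h12 : ∑ k, of (soloInformedSegRep (g k) (c k)) -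
      ∑ i, of (soloInformedSegRep (γ i) (e i)) ∈ relations := by
    rw [Fintype.sum_sum_type]
    simp only [he_def, hγ_def, Sum.elim_inl, Sum.elim_inr, soloInformed_segRep_conj]
    rw [← Finset.sum_add_distrib, ← Finset.sum_sub_distrib]
    refine sum_mem fun k _ => ?_
    have h1 := soloInformed_segRep_sub_halving_mem_relations (hgalg k) (hadm k).2.1 (hadm k).2.2
    have h2 := soloInformed_segRep_add_sub_mem_relations (hgalg k) (hgalg k) (d k)
    rw [← two_mul] at h2
    have := relations.add_mem h1 h2
    convert this using 1
    abel
  -- Step 3: expand the coefficients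
  have h3 : ∀ i, of (soloInformedSegRep (γ i) (e i)) -
      ∑ j, M j i • of (soloInformedSegRep (β j) (e i)) ∈ relations := by
    intro i
    rw [hγM i]
    have hfs := soloInformed_segRep_finset_sum_sub_mem_relations (e i) Finset.univ
      (x := fun j => (M j i : ℂ) * β j) (fun j _ => (isAlgebraic_int (M j i)).mul (hβalg j))
    have hz : ∀ j, M j i • of (soloInformedSegRep (β j) (e i)) -
        of (soloInformedSegRep ((M j i : ℂ) * β j) (e i)) ∈ relations := fun j =>
      soloInformed_segRep_zsmul_sub_mem_relations (hβalg j) (e i) (M j i)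
    have := relations.sub_mem hfs (sum_mem fun j (_ : j ∈ Finset.univ) => hz j)
    rw [Finset.sum_sub_distrib] at this
    convert this using 1
    abel
  -- Step 4: integer null relations, coefficient by coefficient
  have h4 : ∑ i, ∑ j, M j i • of (soloInformedSegRep (β j) (e i)) ∈ relations := by
    rw [Finset.sum_comm]
    exact sum_mem fun j _ =>
      soloInformed_zsmul_segRep_sum_mem_relations (hβalg j) healg hesp (fun i => M j i) (hMrel j)
  -- assemble
  have hS : ∑ i, of (soloInformedSegRep (γ i) (e i)) ∈ relations := by
    have := relations.add_mem (sum_mem fun i (_ : i ∈ Finset.univ) => h3 i) h4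
    rw [← Finset.sum_add_distrib] at this
    simpa only [sub_add_cancel] using this
  have hK : ∑ k, of (soloInformedSegRep (g k) (c k)) ∈ relations := by
    have := relations.add_mem h12 hS
    simpa using this
  have hP : of (soloInformedPtRep a ha) ∈ relations := by
    have := relations.add_mem (soloInformed_ptRep_congr_sub_mem_relations ha isAlgebraic_zero ha0')
      soloInformed_ptRep_zero_mem_relations
    simpa using this
  exact relations.add_mem hP hK

end Summit.KontsevichZagierPeriods.KontsevichZagierPeriods.Theorems
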